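import Summits.ValiantsHypothesis.ValiantsHypothesis.Theorems.KPlusLogSqLawTropicalBParityLaw

/-!
# Route «KPlusLogSqLaw», crux `TropicalB` (stmt-ValiantsHypothesis-19771) — THE TOP-HEAVY CORE, part 1 (structure):
# three dominant terms of class types `c₁^{m−2}c₂²`, `c₁^{m−1}c₃`, `c₀^{m−1}c₄` have HAMILTONIAN quotients against the third and a SINGLE
# changed orbit between the first two

HONEST FRAMING.  Structure lemmas (first kernel part) of the located all-`m` «CORE LAW C» of this seat (val-sym-trop-p1 g21, cell `pub-symmetroid`,
2026-08-28; memo HOME/val-sym-trop-p1/g21/CORE-LAW-C-g21.md = evidence on stmt-ValiantsHypothesis-19771; `--supports … --as helper`): for classes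
`c₀, …, c₄` with exponents `d c₀ < d c₁ < d c₂ < d c₃` and a dominant top class, no design has dominant terms `P_A` (class `c₂` at two columns `a₁ ≠ a₂`,
`c₁` elsewhere), `P_B` (`c₃` at one column `b`, `c₁` elsewhere), `P_C` (`c₄` at one column `c`, `c₀` elsewhere) with `P_C` last — whence `(m,5)` is not
counting-tight on the region `d₄ + (m−1)d₀ > max((m−2)d₁ + 2d₂, (m−1)d₁ + d₃)` (LOCATED for `m ≤ 6` by complete CSP+LP searches, proof complete on
paper in the memo; the one-jump Latin transversal and the winding argument are parts 2–3, NOT in this file).  Valid for every design at every format;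
nothing here bears on `TropicalB` in its window, `WeakLifting`, the doors, `MatrixDescartes` (stmt-ValiantsHypothesis-18050) or VP ≠ VNP.

THIS FILE.
* `hamiltonian_AC`, `hamiltonian_BC` — if `P_A` (resp. `P_B`) is dominant earlier than `P_C`, the quotient `σ_A⁻¹σ_C` (resp. `σ_B⁻¹σ_C`) moves every
  column and is a single cycle through `c` (`ParityLaw.hamiltonian_quotient` with `s = c`: off `c` the class of `P_C` is `c₀`, strictly below every class
  of `P_A`, `P_B`).
* `sum_sub_sum_AB` — bookkeeping: on any column set `T`, `Σ_T d(λ_B) − Σ_T d(λ_A) = [b ∈ T](d c₃ − d c₁) − #({a₁,a₂} ∩ T)(d c₂ − d c₁)`.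
* **`no_split_AB`** — whichever of `P_A`, `P_B` is earlier, NO column set `T` invariant under `σ_A⁻¹σ_B` sees differences both on `T` and off `T`
  (cyclewise monotonicity `sum_d_lt_of_isDominant_split` on both sides + the bookkeeping: the side without `b` cannot gain mass from `A` to `B`; the side
  with `b` and at most one `aᵢ` cannot lose mass from `B` to `A`; a side with no special column has equal masses);
  `sameCycle_AB` — hence all columns where `P_A`, `P_B` differ (in particular `a₁`, `a₂`, `b`) lie on ONE cycle of `σ_A⁻¹σ_B`.
[exchange argument on the tree's cyclewise monotonicity; the packaging is this cell's]
-/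

set_option linter.dupNamespace false
set_option autoImplicit false

namespace Summit.ValiantsHypothesis.ValiantsHypothesis.Theorems.KPlusLogSqLaw.TopHeavyCore

open Summit.ValiantsHypothesis.ValiantsHypothesis.Theorems.MatrixDescartes.Negative
open scoped BigOperators
open Finset

variable {m K : ℕ}

/-! ## 1. Hamiltonian quotients against the top term -/

/-- **`σ_A⁻¹σ_C` is Hamiltonian.**  `P_A = (σA, lA)` dominant at `θA`, `P_C = (σC, lC)` dominant at `θC > θA`; `lC b = c₀` for `b ≠ c` and every class of
`P_A` has exponent above `d c₀`.  Then `σA⁻¹σC` moves every column and is a single cycle through `c`. [`ParityLaw.hamiltonian_quotient`] -/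
theorem hamiltonian_AC (d : Fin K → ℕ) (v ε : Fin m → Fin m → Fin K → ℤ) {θA θC : ℤ} (hAC : θA < θC)
    {σA σC : Equiv.Perm (Fin m)} {lA lC : Fin m → Fin K} (hA : IsDominant d v ε θA (σA, lA)) (hC : IsDominant d v ε θC (σC, lC))
    (c : Fin m) {c₀ : Fin K} (hlC : ∀ b, b ≠ c → lC b = c₀) (hlow : ∀ b, d c₀ < d (lA b)) (hm : 2 ≤ m) :
    (∀ b, (σA⁻¹ * σC) b ≠ b) ∧ ∀ b, (σA⁻¹ * σC).SameCycle c b :=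
  ParityLaw.hamiltonian_quotient d v ε hAC hA hC c (fun b hb => by rw [hlC b hb]; exact hlow b) hm

/-! ## 2. The single changed orbit between `P_A` and `P_B` -/

section AB

variable (d : Fin K → ℕ) {c₁ c₂ c₃ : Fin K} {a₁ a₂ b : Fin m} {lA lB : Fin m → Fin K}

/-- exponent of `P_A`'s class at a column: `d c₁ + [x ∈ {a₁,a₂}]·(d c₂ − d c₁)`. -/
theorem dA_eq (hlA : ∀ x, lA x = if x = a₁ ∨ x = a₂ then c₂ else c₁) (x : Fin m) :
    (d (lA x) : ℤ) = d c₁ + (if x = a₁ ∨ x = a₂ then ((d c₂ : ℤ) - d c₁) else 0) := by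
  rw [hlA x]; split_ifs <;> ring

/-- exponent of `P_B`'s class at a column: `d c₁ + [x = b]·(d c₃ − d c₁)`. -/
theorem dB_eq (hlB : ∀ x, lB x = if x = b then c₃ else c₁) (x : Fin m) :
    (d (lB x) : ℤ) = d c₁ + (if x = b then ((d c₃ : ℤ) - d c₁) else 0) := by
  rw [hlB x]; split_ifs <;> ring

/-- **bookkeeping**: on any column set `T`,
`Σ_T d(λ_B) − Σ_T d(λ_A) = [b ∈ T](d c₃ − d c₁) − #(T ∩ {a₁, a₂})·(d c₂ − d c₁)`. [this file] -/
theorem sum_sub_sum_AB (hlA : ∀ x, lA x = if x = a₁ ∨ x = a₂ then c₂ else c₁)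
    (hlB : ∀ x, lB x = if x = b then c₃ else c₁) (T : Finset (Fin m)) :
    ∑ x ∈ T, (d (lB x) : ℤ) - ∑ x ∈ T, (d (lA x) : ℤ) =
      (if b ∈ T then ((d c₃ : ℤ) - d c₁) else 0) - (T.filter fun x => x = a₁ ∨ x = a₂).card * ((d c₂ : ℤ) - d c₁) := by
  classical
  have h1 : ∑ x ∈ T, (d (lB x) : ℤ) = ∑ x ∈ T, ((d c₁ : ℤ) + (if x = b then ((d c₃ : ℤ) - d c₁) else 0)) :=
    Finset.sum_congr rfl fun x _ => dB_eq d hlB x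
  have h2 : ∑ x ∈ T, (d (lA x) : ℤ) = ∑ x ∈ T, ((d c₁ : ℤ) + (if x = a₁ ∨ x = a₂ then ((d c₂ : ℤ) - d c₁) else 0)) :=
    Finset.sum_congr rfl fun x _ => dA_eq d hlA x
  have hb : ∑ x ∈ T, (if x = b then ((d c₃ : ℤ) - d c₁) else 0) = if b ∈ T then ((d c₃ : ℤ) - d c₁) else 0 :=
    Finset.sum_ite_eq' T b _
  have ha : ∑ x ∈ T, (if x = a₁ ∨ x = a₂ then ((d c₂ : ℤ) - d c₁) else 0) =
      (T.filter fun x => x = a₁ ∨ x = a₂).card * ((d c₂ : ℤ) - d c₁) := by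
    rw [← Finset.sum_filter, Finset.sum_const, nsmul_eq_mul]
  rw [h1, h2, Finset.sum_add_distrib, Finset.sum_add_distrib, hb, ha]
  ring

variable (v ε : Fin m → Fin m → Fin K → ℤ)

/-- **NO SPLIT between `P_A` and `P_B`.**  `P_A = (σA, lA)` (class `c₂` at `a₁ ≠ a₂`, `c₁` elsewhere) and `P_B = (σB, lB)` (class `c₃` at `b`, `c₁`
elsewhere), `d c₁ < d c₂ < d c₃`, both dominant (in either order).  Then no column set invariant under `σA⁻¹σB` sees differences both on it and off it.
[this file] -/
theorem no_split_AB {θA θB : ℤ} (hθ : θA ≠ θB) {σA σB : Equiv.Perm (Fin m)}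
    (hA : IsDominant d v ε θA (σA, lA)) (hB : IsDominant d v ε θB (σB, lB))
    (hne : a₁ ≠ a₂) (hlA : ∀ x, lA x = if x = a₁ ∨ x = a₂ then c₂ else c₁) (hlB : ∀ x, lB x = if x = b then c₃ else c₁)
    (h12 : d c₁ < d c₂) (h23 : d c₂ < d c₃)
    (T : Finset (Fin m)) (hT : ∀ x, (σA⁻¹ * σB) x ∈ T ↔ x ∈ T)
    (hin : ∃ x ∈ T, σA x ≠ σB x ∨ lA x ≠ lB x) (hout : ∃ x ∉ T, σA x ≠ σB x ∨ lA x ≠ lB x) : False := by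
  classical
  have hTc : ∀ x, (σA⁻¹ * σB) x ∈ Tᶜ ↔ x ∈ Tᶜ := fun x => by rw [Finset.mem_compl, Finset.mem_compl, hT x]
  -- bookkeeping on both sides
  have eT := sum_sub_sum_AB d hlA hlB T
  have eTc := sum_sub_sum_AB d hlA hlB Tᶜ
  -- the filter cardinalities are at most 2 and add up to 2; memberships
  have hcardT : (T.filter fun x => x = a₁ ∨ x = a₂).card ≤ 2 := by
    calc (T.filter fun x => x = a₁ ∨ x = a₂).card ≤ ({a₁, a₂} : Finset (Fin m)).card :=
          Finset.card_le_card fun x hx => by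
            rcases (Finset.mem_filter.mp hx).2 with h | h <;> simp [h]
      _ ≤ 2 := Finset.card_le_two
  have hcardTc : (Tᶜ.filter fun x => x = a₁ ∨ x = a₂).card ≤ 2 := by
    calc (Tᶜ.filter fun x => x = a₁ ∨ x = a₂).card ≤ ({a₁, a₂} : Finset (Fin m)).card :=
          Finset.card_le_card fun x hx => by
            rcases (Finset.mem_filter.mp hx).2 with h | h <;> simp [h]
      _ ≤ 2 := Finset.card_le_two
  have hsum : (T.filter fun x => x = a₁ ∨ x = a₂).card + (Tᶜ.filter fun x => x = a₁ ∨ x = a₂).card = 2 := by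
    rw [← Finset.card_union_of_disjoint (Finset.disjoint_filter_filter (disjoint_compl_right)), ← Finset.filter_union,
      Finset.union_compl, Finset.filter_or, Finset.filter_eq', Finset.filter_eq']
    simp only [Finset.mem_univ, if_true]
    rw [Finset.card_union_of_disjoint (by simp [hne]), Finset.card_singleton, Finset.card_singleton]
  -- a side containing `b` but not both `aᵢ`, and sign facts
  have hbside : (b ∈ T) ∨ (b ∈ Tᶜ) := by by_cases h : b ∈ T <;> simp [h]
  rcases lt_or_gt_of_ne hθ with hlt | hgt
  · -- `P_A` earlier: both sides gain mass strictly
    obtain ⟨h1, h2⟩ := sum_d_lt_of_isDominant_split d v ε hlt hA hB T hT hin hout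
    -- the side WITHOUT `b` cannot gain
    rcases hbside with hb | hb
    · have hb' : b ∉ Tᶜ := fun h => (Finset.mem_compl.mp h) hb
      rw [if_neg hb'] at eTc
      have : (0 : ℤ) ≤ (Tᶜ.filter fun x => x = a₁ ∨ x = a₂).card * ((d c₂ : ℤ) - d c₁) :=
        mul_nonneg (by positivity) (by have := h12; omega)
      linarith
    · have hb' : b ∉ T := Finset.mem_compl.mp hb
      rw [if_neg hb'] at eT
      have : (0 : ℤ) ≤ (T.filter fun x => x = a₁ ∨ x = a₂).card * ((d c₂ : ℤ) - d c₁) :=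
        mul_nonneg (by positivity) (by have := h12; omega)
      linarith
  · -- `P_B` earlier: both sides lose mass strictly from `B` to `A`
    have hinv : (σB⁻¹ * σA) = (σA⁻¹ * σB)⁻¹ := by rw [mul_inv_rev, inv_inv]
    have hT' : ∀ x, (σB⁻¹ * σA) x ∈ T ↔ x ∈ T := by
      intro x
      rw [hinv]
      have h := hT ((σA⁻¹ * σB)⁻¹ x)
      rw [← Equiv.Perm.mul_apply, mul_inv_cancel, Equiv.Perm.one_apply] at h
      exact h.symm
    have hin' : ∃ x ∈ T, σB x ≠ σA x ∨ lB x ≠ lA x := by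
      obtain ⟨x, hx, h⟩ := hin
      exact ⟨x, hx, h.imp Ne.symm Ne.symm⟩
    have hout' : ∃ x ∉ T, σB x ≠ σA x ∨ lB x ≠ lA x := by
      obtain ⟨x, hx, h⟩ := hout
      exact ⟨x, hx, h.imp Ne.symm Ne.symm⟩
    obtain ⟨h1, h2⟩ := sum_d_lt_of_isDominant_split d v ε hgt hB hA T hT' hin' hout'
    -- case analysis on where `b` is and how many `aᵢ` accompany it
    have hc2 : ((d c₂ : ℤ) - d c₁) > 0 := by have := h12; omega
    have hc3 : ((d c₃ : ℤ) - d c₁) > 2 * 0 := by have := h23; have := h12; omega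
    rcases hbside with hb | hb
    · rw [if_pos hb] at eT
      have hb' : b ∉ Tᶜ := fun h => (Finset.mem_compl.mp h) hb
      rw [if_neg hb'] at eTc
      -- on `Tᶜ`: loss means `#a(Tᶜ)·(c₂−c₁) > 0`, so `#a(Tᶜ) ≥ 1`, so `#a(T) ≤ 1`; on `T`: `(c₃−c₁) − #a(T)(c₂−c₁) < 0` needs `#a(T) ≥ 2`
      have k1 : 1 ≤ (Tᶜ.filter fun x => x = a₁ ∨ x = a₂).card := by
        by_contra hk
        push Not at hk
        have : (Tᶜ.filter fun x => x = a₁ ∨ x = a₂).card = 0 := by omega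
        rw [this] at eTc; simp at eTc; linarith
      have k2 : (T.filter fun x => x = a₁ ∨ x = a₂).card ≤ 1 := by omega
      have : ((T.filter fun x => x = a₁ ∨ x = a₂).card : ℤ) * ((d c₂ : ℤ) - d c₁) ≤ 1 * ((d c₂ : ℤ) - d c₁) :=
        mul_le_mul_of_nonneg_right (by exact_mod_cast k2) hc2.le
      have : (d c₂ : ℤ) < d c₃ := by exact_mod_cast h23
      linarith
    · have hbT : b ∉ T := Finset.mem_compl.mp hb
      rw [if_neg hbT] at eT
      rw [if_pos hb] at eTc
      have k1 : 1 ≤ (T.filter fun x => x = a₁ ∨ x = a₂).card := by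
        by_contra hk
        push Not at hk
        have : (T.filter fun x => x = a₁ ∨ x = a₂).card = 0 := by omega
        rw [this] at eT; simp at eT; linarith
      have k2 : (Tᶜ.filter fun x => x = a₁ ∨ x = a₂).card ≤ 1 := by omega
      have : ((Tᶜ.filter fun x => x = a₁ ∨ x = a₂).card : ℤ) * ((d c₂ : ℤ) - d c₁) ≤ 1 * ((d c₂ : ℤ) - d c₁) :=
        mul_le_mul_of_nonneg_right (by exact_mod_cast k2) hc2.le
      have : (d c₂ : ℤ) < d c₃ := by exact_mod_cast h23
      linarith

/-- **SINGLE CHANGED ORBIT.**  In the situation of `no_split_AB`, all columns where `P_A` and `P_B` differ lie on ONE cycle of `σA⁻¹σB`; in particular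
`a₁`, `a₂`, `b` (where the classes differ) are on one cycle. [this file] -/
theorem sameCycle_AB {θA θB : ℤ} (hθ : θA ≠ θB) {σA σB : Equiv.Perm (Fin m)}
    (hA : IsDominant d v ε θA (σA, lA)) (hB : IsDominant d v ε θB (σB, lB))
    (hne : a₁ ≠ a₂) (hlA : ∀ x, lA x = if x = a₁ ∨ x = a₂ then c₂ else c₁) (hlB : ∀ x, lB x = if x = b then c₃ else c₁)
    (h12 : d c₁ < d c₂) (h23 : d c₂ < d c₃) {x y : Fin m}
    (hx : σA x ≠ σB x ∨ lA x ≠ lB x) (hy : σA y ≠ σB y ∨ lA y ≠ lB y) : (σA⁻¹ * σB).SameCycle x y := by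
  classical
  by_contra hnot
  set π := σA⁻¹ * σB with hπ
  let T : Finset (Fin m) := Finset.univ.filter fun z => π.SameCycle x z
  have hT : ∀ z, π z ∈ T ↔ z ∈ T := by
    intro z
    simp only [T, Finset.mem_filter, Finset.mem_univ, true_and]
    exact Equiv.Perm.sameCycle_apply_right
  exact no_split_AB d v ε hθ hA hB hne hlA hlB h12 h23 T hT
    ⟨x, Finset.mem_filter.mpr ⟨Finset.mem_univ _, Equiv.Perm.SameCycle.refl _ _⟩, hx⟩
    ⟨y, fun h => hnot (Finset.mem_filter.mp h).2, hy⟩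

/-- the three special columns are on one cycle of `σA⁻¹σB` (classes differ there: `c₂ ≠ c₁` at `aᵢ`, `c₃ ≠ c₁, c₂` at `b`). [this file] -/
theorem sameCycle_specials {θA θB : ℤ} (hθ : θA ≠ θB) {σA σB : Equiv.Perm (Fin m)}
    (hA : IsDominant d v ε θA (σA, lA)) (hB : IsDominant d v ε θB (σB, lB))
    (hne : a₁ ≠ a₂) (hlA : ∀ x, lA x = if x = a₁ ∨ x = a₂ then c₂ else c₁) (hlB : ∀ x, lB x = if x = b then c₃ else c₁)
    (h12 : d c₁ < d c₂) (h23 : d c₂ < d c₃) :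
    (σA⁻¹ * σB).SameCycle a₁ a₂ ∧ (σA⁻¹ * σB).SameCycle a₁ b := by
  have hc12 : c₁ ≠ c₂ := fun h => by rw [h] at h12; exact lt_irrefl _ h12
  have hc13 : c₁ ≠ c₃ := fun h => by rw [h] at h12; exact lt_asymm h12 h23
  have hc23 : c₂ ≠ c₃ := fun h => by rw [h] at h23; exact lt_irrefl _ h23
  -- classes differ at a₁, a₂, b
  have da : ∀ a, (a = a₁ ∨ a = a₂) → lA a ≠ lB a := by
    intro a ha
    rw [hlA a, hlB a, if_pos ha]
    split_ifs with hb
    · exact hc23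
    · exact Ne.symm hc12
  have db : lA b ≠ lB b := by
    rw [hlA b, hlB b, if_pos rfl]
    split_ifs with hb
    · exact hc23
    · exact hc13
  exact ⟨sameCycle_AB d v ε hθ hA hB hne hlA hlB h12 h23 (Or.inr (da a₁ (Or.inl rfl))) (Or.inr (da a₂ (Or.inr rfl))),
    sameCycle_AB d v ε hθ hA hB hne hlA hlB h12 h23 (Or.inr (da a₁ (Or.inl rfl))) (Or.inr db)⟩

end AB

end Summit.ValiantsHypothesis.ValiantsHypothesis.Theorems.KPlusLogSqLaw.TopHeavyCore
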